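import Literature.Barriers.CriticalPhenomena.LaceExpansionKernelTaylor
import Mathlib.Analysis.SpecialFunctions.Gaussian.FourierTransform
import Mathlib.Analysis.SpecialFunctions.Gaussian.GaussianIntegral
import Mathlib.MeasureTheory.Integral.Pi
import Mathlib.MeasureTheory.Integral.Gamma
import Mathlib.Analysis.MeanInequalitiesPow
import HarnessLib

/-!
# Gaussian integrals on `ℝ^d` in product form (for Hara 2008, Lemma 2.2)

Barrier catalogue `Literature/Barriers/CriticalPhenomena/` (D-0021), infrastructure for the proof
of the named fact `Hara2008_lem22` (`LaceExpansionGaussianLargeT.lean`). `k`-space is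
`Fin d → ℝ` with Lebesgue measure (`volume = Measure.pi`), so Gaussian integrals factorise over the
coordinates (`MeasureTheory.integral_fintype_prod_volume_eq_prod`). All PROVED, [folklore] unless
Hara's display is cited:

* `rpow_mul_exp_neg_le` (`s^βe^{-s} ≤ (β/e)^β`), `abs_rpow_mul_exp_neg_mul_sq_le`;
* one-dimensional moments `∫_ℝ |s|^q e^{-bs²} ds = b^{-(q+1)/2}Γ((q+1)/2)` and their integrability;
* `∫_{ℝ^d} e^{-b|k|²} = (π/b)^{d/2}`, `∫_{ℝ^d} |k_j|^q e^{-b|k|²} = b^{-(q+1)/2}Γ((q+1)/2)(π/b)^{(d-1)/2}`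
  (with integrability);
* the power-mean bound `(Σ_i k_i²)^p ≤ d^{p-1} Σ_i |k_i|^{2p}` (`p ≥ 1`), used to dominate
  `|k|^{2+ρ'}` by coordinate monomials;
* the Gaussian Fourier integral `∫_{ℝ^d} e^{ik·x} e^{-b|k|²} dk = (π/b)^{d/2} e^{-|x|²/(4b)}`
  (Hara 2008, (2.25): "calculated exactly by completing the square"; here from Mathlib's
  `fourierIntegral_gaussian` coordinatewise).

## References

* T. Hara, Ann. Probab. 36 (2008) 530–593 (arXiv:math-ph/0504021): proof of Lemma 2.2,
  (2.17), (2.24)–(2.25).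
-/

noncomputable section

namespace Literature.Barriers.CriticalPhenomena

open MeasureTheory Filter Finset Literature.Probability.LatticeModels Literature.Probability.Percolation
open scoped Topology BigOperators

variable {d : ℕ}

/-! ### Elementary inequalities -/

/-- `s^β e^{-s} ≤ (β/e)^β` for `s, β > 0` (the maximum of `s^β e^{-s}` is at `s = β`; from
`log u ≤ u - 1`). [cite: Hara2008, proof of (2.5), display (2.17)] -/
theorem rpow_mul_exp_neg_le {s β : ℝ} (hs : 0 < s) (hβ : 0 < β) :
    s ^ β * Real.exp (-s) ≤ (β / Real.exp 1) ^ β := by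
  have hlog : Real.log (s / β) ≤ s / β - 1 := Real.log_le_sub_one_of_pos (by positivity)
  rw [Real.log_div hs.ne' hβ.ne'] at hlog
  have h1 : β * (Real.log s - Real.log β) ≤ s - β := by
    have := mul_le_mul_of_nonneg_left hlog hβ.le
    have e : β * (s / β - 1) = s - β := by field_simp
    linarith
  rw [Real.rpow_def_of_pos hs, ← Real.exp_add, Real.rpow_def_of_pos (by positivity),
    Real.log_div hβ.ne' (Real.exp_pos 1).ne', Real.log_exp]
  exact Real.exp_le_exp.2 (by nlinarith)

/-- `|s|^q e^{-bs²} ≤ (q/(eb))^{q/2} e^{-(b/2)s²}` for `q, b > 0`. [folklore] -/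
theorem abs_rpow_mul_exp_neg_mul_sq_le {b q : ℝ} (hb : 0 < b) (hq : 0 < q) (s : ℝ) :
    |s| ^ q * Real.exp (-b * s ^ 2) ≤ (q / (Real.exp 1 * b)) ^ (q / 2) * Real.exp (-(b / 2) * s ^ 2) := by
  rcases (sq_nonneg s).eq_or_lt with h0 | h0
  · have : s = 0 := by nlinarith
    subst this
    simp [Real.zero_rpow hq.ne']
    positivity
  -- `u = (b/2) s² > 0`, `β = q/2`
  set u : ℝ := b / 2 * s ^ 2 with hu
  have hu0 : 0 < u := by positivity
  have hkey := rpow_mul_exp_neg_le hu0 (half_pos hq)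
  have habs : |s| ^ q = (2 / b) ^ (q / 2) * u ^ (q / 2) := by
    rw [← Real.mul_rpow (by positivity) hu0.le, show 2 / b * u = |s| ^ (2 : ℝ) by
      rw [hu, show |s| ^ (2 : ℝ) = s ^ 2 by rw [← sq_abs]; norm_cast]; field_simp,
      ← Real.rpow_mul (abs_nonneg s)]
    congr 1; ring
  have hsplit : Real.exp (-b * s ^ 2) = Real.exp (-u) * Real.exp (-(b / 2) * s ^ 2) := by
    rw [← Real.exp_add]; congr 1; rw [hu]; ring
  rw [habs, hsplit]
  calc (2 / b) ^ (q / 2) * u ^ (q / 2) * (Real.exp (-u) * Real.exp (-(b / 2) * s ^ 2))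
      = (2 / b) ^ (q / 2) * (u ^ (q / 2) * Real.exp (-u)) * Real.exp (-(b / 2) * s ^ 2) := by ring
    _ ≤ (2 / b) ^ (q / 2) * (q / 2 / Real.exp 1) ^ (q / 2) * Real.exp (-(b / 2) * s ^ 2) := by
        gcongr
    _ = (q / (Real.exp 1 * b)) ^ (q / 2) * Real.exp (-(b / 2) * s ^ 2) := by
        rw [← Real.mul_rpow (by positivity) (by positivity)]
        congr 2; field_simp

/-! ### One-dimensional Gaussian moments -/

/-- `∫_ℝ |s|^q e^{-bs²} ds = b^{-(q+1)/2} Γ((q+1)/2)` for `b > 0`, `q > -1`. [folklore] -/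
theorem integral_abs_rpow_mul_exp_neg_mul_sq {b q : ℝ} (hb : 0 < b) (hq : -1 < q) :
    ∫ s : ℝ, |s| ^ q * Real.exp (-b * s ^ 2) = b ^ (-(q + 1) / 2) * Real.Gamma ((q + 1) / 2) := by
  have h := integral_comp_abs (f := fun u => u ^ q * Real.exp (-b * u ^ 2))
  simp only [sq_abs] at h
  rw [h]
  have h2 := integral_rpow_mul_exp_neg_mul_rpow (p := 2) (q := q) two_pos hq hb
  have h2' : ∫ x in Set.Ioi (0 : ℝ), x ^ q * Real.exp (-b * x ^ 2) =
      b ^ (-(q + 1) / 2) * (1 / 2) * Real.Gamma ((q + 1) / 2) := by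
    rw [← h2]
    refine setIntegral_congr_fun measurableSet_Ioi fun x _ => ?_
    rw [show x ^ (2 : ℝ) = x ^ 2 by norm_cast]
  rw [h2']; ring

/-- `|s|^q e^{-bs²}` is integrable on `ℝ` (`q ≥ 0`, `b > 0`). [folklore] -/
theorem integrable_abs_rpow_mul_exp_neg_mul_sq {b q : ℝ} (hb : 0 < b) (hq : 0 ≤ q) :
    Integrable fun s : ℝ => |s| ^ q * Real.exp (-b * s ^ 2) := by
  rcases hq.eq_or_lt with h0 | h0
  · subst h0; simpa using integrable_exp_neg_mul_sq hb
  have hmeas : AEStronglyMeasurable (fun s : ℝ => |s| ^ q * Real.exp (-b * s ^ 2)) volume := by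
    refine (Continuous.mul ?_ ?_).aestronglyMeasurable
    · exact (Real.continuous_rpow_const hq).comp continuous_abs
    · fun_prop
  refine Integrable.mono' ((integrable_exp_neg_mul_sq (half_pos hb)).const_mul
    ((q / (Real.exp 1 * b)) ^ (q / 2))) hmeas (Filter.Eventually.of_forall fun s => ?_)
  rw [Real.norm_eq_abs, abs_of_nonneg (by positivity)]
  exact abs_rpow_mul_exp_neg_mul_sq_le hb h0 s

/-! ### Gaussian integrals on `ℝ^d` -/

/-- The product structure of `e^{-b|k|²}` on `ℝ^d = (Fin d → ℝ)`. [folklore] -/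
theorem exp_neg_mul_sum_sq (b : ℝ) (k : Fin d → ℝ) :
    Real.exp (-b * ∑ i, k i ^ 2) = ∏ i, Real.exp (-b * k i ^ 2) := by
  rw [Finset.mul_sum, Real.exp_sum]

/-- `∫_{ℝ^d} e^{-b|k|²} dk = (π/b)^{d/2}`. [folklore] -/
theorem integral_exp_neg_mul_sum_sq {b : ℝ} (hb : 0 < b) :
    ∫ k : Fin d → ℝ, Real.exp (-b * ∑ i, k i ^ 2) = (Real.pi / b) ^ ((d : ℝ) / 2) := by
  simp_rw [exp_neg_mul_sum_sq]
  rw [integral_fintype_prod_volume_eq_prod (fun (_ : Fin d) (s : ℝ) => Real.exp (-b * s ^ 2))]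
  simp only [integral_gaussian, Finset.prod_const, Finset.card_univ, Fintype.card_fin]
  rw [Real.sqrt_eq_rpow, ← Real.rpow_natCast, ← Real.rpow_mul (by positivity)]
  congr 1; ring

/-- `e^{-b|k|²}` is integrable on `ℝ^d`. [folklore] -/
theorem integrable_exp_neg_mul_sum_sq {b : ℝ} (hb : 0 < b) :
    Integrable fun k : Fin d → ℝ => Real.exp (-b * ∑ i, k i ^ 2) := by
  simp_rw [exp_neg_mul_sum_sq]
  exact Integrable.fintype_prod (f := fun (_ : Fin d) (s : ℝ) => Real.exp (-b * s ^ 2))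
    fun _ => integrable_exp_neg_mul_sq hb

/-- `|k_j|^q e^{-b|k|²}` in product form. [folklore] -/
theorem abs_apply_rpow_mul_exp_neg_mul_sum_sq_eq_prod (b q : ℝ) (j : Fin d) (k : Fin d → ℝ) :
    |k j| ^ q * Real.exp (-b * ∑ i, k i ^ 2) =
      ∏ i, Function.update (fun (_ : Fin d) (s : ℝ) => Real.exp (-b * s ^ 2)) j
        (fun s => |s| ^ q * Real.exp (-b * s ^ 2)) i (k i) := by
  classical
  set g : Fin d → ℝ → ℝ := Function.update (fun (_ : Fin d) (s : ℝ) => Real.exp (-b * s ^ 2)) j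
    (fun s => |s| ^ q * Real.exp (-b * s ^ 2)) with hg
  have hgj : g j (k j) = |k j| ^ q * Real.exp (-b * k j ^ 2) := by simp [hg]
  have hgi : ∀ i ∈ Finset.univ.erase j, g i (k i) = Real.exp (-b * k i ^ 2) := fun i hi => by
    simp [hg, Function.update_of_ne (Finset.ne_of_mem_erase hi)]
  rw [exp_neg_mul_sum_sq, ← Finset.mul_prod_erase Finset.univ (fun i => Real.exp (-b * k i ^ 2)) (Finset.mem_univ j),
    ← Finset.mul_prod_erase Finset.univ (fun i => g i (k i)) (Finset.mem_univ j), hgj,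
    Finset.prod_congr rfl hgi]
  ring

/-- `|k_j|^q e^{-b|k|²}` is integrable on `ℝ^d` and
`∫ |k_j|^q e^{-b|k|²} dk = b^{-(q+1)/2} Γ((q+1)/2) (π/b)^{(d-1)/2}` (`q ≥ 0`, `b > 0`, `d ≥ 1`).
[folklore] -/
theorem integral_abs_apply_rpow_mul_exp_neg_mul_sum_sq (hd : 1 ≤ d) {b q : ℝ} (hb : 0 < b) (hq : 0 ≤ q)
    (j : Fin d) :
    Integrable (fun k : Fin d → ℝ => |k j| ^ q * Real.exp (-b * ∑ i, k i ^ 2)) ∧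
    ∫ k : Fin d → ℝ, |k j| ^ q * Real.exp (-b * ∑ i, k i ^ 2) =
      b ^ (-(q + 1) / 2) * Real.Gamma ((q + 1) / 2) * (Real.pi / b) ^ (((d : ℝ) - 1) / 2) := by
  classical
  set g : Fin d → ℝ → ℝ := Function.update (fun (_ : Fin d) (s : ℝ) => Real.exp (-b * s ^ 2)) j
    (fun s => |s| ^ q * Real.exp (-b * s ^ 2)) with hg
  have hgi : ∀ i, Integrable (g i) := by
    intro i
    by_cases hi : i = j
    · subst hi; simp only [hg, Function.update_self]; exact integrable_abs_rpow_mul_exp_neg_mul_sq hb hq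
    · simp only [hg, Function.update_of_ne hi]; exact integrable_exp_neg_mul_sq hb
  simp_rw [abs_apply_rpow_mul_exp_neg_mul_sum_sq_eq_prod b q j]
  refine ⟨Integrable.fintype_prod hgi, ?_⟩
  rw [integral_fintype_prod_volume_eq_prod g, ← Finset.mul_prod_erase Finset.univ _ (Finset.mem_univ j)]
  simp only [hg, Function.update_self]
  rw [integral_abs_rpow_mul_exp_neg_mul_sq hb (by linarith)]
  rw [Finset.prod_congr rfl fun i hi => by rw [Function.update_of_ne (Finset.ne_of_mem_erase hi)]]
  simp only [integral_gaussian, Finset.prod_const, Finset.card_erase_of_mem (Finset.mem_univ j),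
    Finset.card_univ, Fintype.card_fin]
  rw [Real.sqrt_eq_rpow, ← Real.rpow_natCast, ← Real.rpow_mul (by positivity), Nat.cast_sub hd]
  congr 1; push_cast; ring

/-- **Power-mean bound** `|k|^{2p} = (Σ_i k_i²)^p ≤ d^{p-1} Σ_i |k_i|^{2p}` for `p ≥ 1` (convexity of
`u ↦ u^p`). [folklore] -/
theorem sum_sq_rpow_le (hd : 1 ≤ d) {p : ℝ} (hp : 1 ≤ p) (k : Fin d → ℝ) :
    (∑ i, k i ^ 2) ^ p ≤ (d : ℝ) ^ (p - 1) * ∑ i, |k i| ^ (2 * p) := by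
  have hd0 : (0 : ℝ) < d := by exact_mod_cast hd
  have h := Real.rpow_arith_mean_le_arith_mean_rpow Finset.univ (fun _ : Fin d => (1 : ℝ) / d)
    (fun i => k i ^ 2) (fun _ _ => by positivity) (by
      rw [Finset.sum_const, Finset.card_univ, Fintype.card_fin, nsmul_eq_mul]; field_simp)
    (fun i _ => sq_nonneg (k i)) hp
  -- `h : (Σ (1/d) k_i²)^p ≤ Σ (1/d) (k_i²)^p`
  have hl : (∑ i, (1 : ℝ) / d * k i ^ 2) ^ p = (d : ℝ) ^ (-p) * (∑ i, k i ^ 2) ^ p := by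
    rw [← Finset.mul_sum, Real.mul_rpow (by positivity) (Finset.sum_nonneg fun i _ => sq_nonneg (k i)),
      one_div, Real.inv_rpow hd0.le, Real.rpow_neg hd0.le]
  have hr : ∑ i, (1 : ℝ) / d * (k i ^ 2) ^ p = (d : ℝ)⁻¹ * ∑ i, |k i| ^ (2 * p) := by
    rw [← Finset.mul_sum, one_div]
    congr 1
    refine Finset.sum_congr rfl fun i _ => ?_
    rw [← sq_abs, show |k i| ^ 2 = |k i| ^ (2 : ℝ) by norm_cast, ← Real.rpow_mul (abs_nonneg _)]
  rw [hl, hr] at h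
  have hdp : 0 < (d : ℝ) ^ (-p) := Real.rpow_pos_of_pos hd0 _
  calc (∑ i, k i ^ 2) ^ p = (d : ℝ) ^ p * ((d : ℝ) ^ (-p) * (∑ i, k i ^ 2) ^ p) := by
        rw [← mul_assoc, ← Real.rpow_add hd0, add_neg_cancel, Real.rpow_zero, one_mul]
    _ ≤ (d : ℝ) ^ p * ((d : ℝ)⁻¹ * ∑ i, |k i| ^ (2 * p)) :=
        mul_le_mul_of_nonneg_left h (Real.rpow_nonneg hd0.le _)
    _ = (d : ℝ) ^ (p - 1) * ∑ i, |k i| ^ (2 * p) := by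
        rw [← mul_assoc, Real.rpow_sub_one hd0.ne', div_eq_mul_inv]

/-- **The Gaussian Fourier integral on `ℝ^d`**:
`∫_{ℝ^d} e^{ik·x} e^{-b|k|²} dk = (π/b)^{d/2} e^{-|x|²/(4b)}` for `b > 0`, `x ∈ ℤ^d` — "calculated
exactly by completing the square", here coordinatewise from Mathlib's `fourierIntegral_gaussian`.
[cite: Hara2008, proof of Lemma 2.2, display (2.25)] -/
theorem integral_cexp_kdot_mul_exp_neg_mul_sum_sq {b : ℝ} (hb : 0 < b) (x : Site d) :
    ∫ k : Fin d → ℝ, Complex.exp (Complex.I * (kdot k x : ℂ)) * (Real.exp (-b * ∑ i, k i ^ 2) : ℂ) =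
      (((Real.pi / b) ^ ((d : ℝ) / 2) * Real.exp (-(euclidNorm x ^ 2 / (4 * b))) : ℝ) : ℂ) := by
  -- product form of the integrand
  set f : Fin d → ℝ → ℂ := fun i s =>
    Complex.exp (Complex.I * ((x i : ℤ) : ℂ) * (s : ℂ)) * Complex.exp (-(b : ℂ) * (s : ℂ) ^ 2) with hf
  have hprod : ∀ k : Fin d → ℝ, Complex.exp (Complex.I * (kdot k x : ℂ)) * (Real.exp (-b * ∑ i, k i ^ 2) : ℂ) =
      ∏ i, f i (k i) := by
    intro k
    simp only [hf, Finset.prod_mul_distrib, ← Complex.exp_sum, kdot, Complex.ofReal_exp]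
    push_cast
    congr 1
    · congr 1; rw [Finset.mul_sum]; refine Finset.sum_congr rfl fun i _ => by ring
    · congr 1; rw [Finset.mul_sum]
  simp_rw [hprod]
  rw [integral_fintype_prod_volume_eq_prod f]
  -- the one-dimensional Fourier–Gauss integrals
  have hbre : 0 < ((b : ℂ)).re := by simpa using hb
  have h1 : ∀ i, ∫ s : ℝ, f i s = ((Real.sqrt (Real.pi / b) : ℝ) : ℂ) *
      Complex.exp (-(((x i : ℤ) : ℂ) ^ 2 / (4 * (b : ℂ)))) := by
    intro i
    simp only [hf]
    rw [fourierIntegral_gaussian hbre]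
    congr 1
    swap
    · rw [neg_div]
    rw [show (Real.pi : ℂ) / (b : ℂ) = ((Real.pi / b : ℝ) : ℂ) by push_cast; ring,
      show (1 / 2 : ℂ) = ((1 / 2 : ℝ) : ℂ) by push_cast; ring,
      ← Complex.ofReal_cpow (by positivity), Real.sqrt_eq_rpow]
  simp_rw [h1]
  rw [Finset.prod_mul_distrib, Finset.prod_const, Finset.card_univ, Fintype.card_fin, ← Complex.exp_sum]
  push_cast
  congr 1
  · rw [← Complex.ofReal_pow, Real.sqrt_eq_rpow, ← Real.rpow_natCast,
      ← Real.rpow_mul (by positivity)]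
    congr 2; ring
  · congr 1
    rw [← Complex.ofReal_pow, euclidNorm_sq, Complex.ofReal_sum, Finset.sum_div, ← Finset.sum_neg_distrib]
    push_cast
    rfl

end Literature.Barriers.CriticalPhenomena
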